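import Summits.HubbardSuperconductivity.HubbardSuperconductivity.Theorems.WidthHaldaneColumnCorrelatorBounds

/-!
# The Bochner floor on the column `d_{x²-y²}` pair correlator of the Hubbard tubes

Crux `WidthHaldaneBridge` (stmt-HubbardSuperconductivity-16311; routes `WidthHaldane`, `SeamInduction`)
asks a POINTWISE floor on the column pair correlator `G_ψ(r) = tubeColumnPairCorr L M Λ e ψ r
= Σ_a Re⟨Φ_a ψ, Φ_{a+r} ψ⟩`, `Φ_a = Σ_b P_{e⁻¹(a,b)}` (`Theorems/WidthHaldaneDefs.lean`), in every
sector ground state. Two crux ideas of the 2026-08-17 round (`bochner-majority-split`, first lemma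
`BochnerFloor`; `pair-repulsion-dual`, support lemma `BochnerFloor`; strategist census gen 1, D3(b))
reduce the `r`-quantifier on wide tubes to TWO SCALARS per state through the kinematic inequality

  `G_ψ(r) ≥ 2‖Δψ‖²/L - G_ψ(0)`,  `Δ = Σ_a Φ_a` the total `d_{x²-y²}` pair field, `‖Δψ‖² = Σ_r G_ψ(r)`,

valid for EVERY Fock vector `ψ`, every labelled tube and every displacement `r` (positive-definiteness
of `r ↦ G_ψ(r)` on `ℤ/L`; sharp for the data `(Ĝ ≥ 0, Ĝ(0), G(0))`). This file PROVES it, in the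
route's own vocabulary and without new definitions, by an argument that needs no characters: apply
the mean-square bound `‖Σ_a u_a‖² ≤ L·Σ_a ‖u_a‖²` to the family `u_a = Φ_a ψ + Φ_{a-r} ψ`, whose sum
is `2Δψ` and whose squares sum to `2G_ψ(0) + 2G_ψ(r)` (using `G_ψ(-r) = G_ψ(r)`).

* `re_star_sum_dotProduct_sum_le` — `‖Σ_{a∈s} u_a‖² ≤ |s|·Σ_{a∈s} ‖u_a‖²` (Cauchy–Schwarz + AM–GM);
* `bochnerFloor_family` — for any family `v : ℤ/L → (n → ℂ)` and shift `r`: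
  `2‖Σ_a v_a‖²/L - Σ_a ‖v_a‖² ≤ Σ_a Re⟨v_a, v_{a+r}⟩`;
* `tubeColumnPairCorr_neg` — `G_ψ(-r) = G_ψ(r)`;
* `sum_tubeColumnPairCorr_eq` — the sum rule `Σ_r G_ψ(r) = ‖Δψ‖²`, and `sum_sum_tubeDWavePair_eq` —
  `Δ = Σ_x P_x` is labelling-free (at `M = L` it is the summit's `d`-wave pair field of the torus);
* **`tubeColumnPairCorr_bochnerFloor`** — `2(Σ_{r'} G_ψ(r'))/L - G_ψ(0) ≤ G_ψ(r)`, and the same with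
  `‖Δψ‖²` written as `Re⟨ψ, Δ†Δ ψ⟩` (`tubeColumnPairCorr_bochnerFloor_expect`);
* `tubeColumnPairCorr_ge_of_majority` — the WIDE-REGIME COMPOSITION of card `bochner-majority-split`:
  tube pair order `A·L²M² ≤ ‖Δψ‖²` and the `k = 0` majority `(1+ε)/2·L·G_ψ(0) ≤ ‖Δψ‖²` give the
  pointwise, exponent-free floor `(2ε/(1+ε))·A·L·M² ≤ G_ψ(r)` at EVERY `r` (real arithmetic).

Kinematics only (no spectral input, no `UniformThermo`): these are handles for the lines of the crux,
not progress on its open core (transverse pair coherence / Luther–Emery universality).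

Sources for the objects only: Scalapino, Phys. Rep. 250 (1995) 329, §2 (column `d_{x²-y²}` pair
field); Bochner–Herglotz positivity on finite cyclic groups is folklore (e.g. Katznelson, *An
Introduction to Harmonic Analysis*, I.§7) — not used: the proof below is the elementary mean-square
bound.
-/

noncomputable section

namespace Summit.HubbardSuperconductivity.HubbardSuperconductivity.Theorems.WidthHaldane

set_option linter.dupNamespace false -- summit = problem name (single-conjunct summit), D-0017

open scoped BigOperators Classical Matrix ComplexConjugate
open Matrix Literature.MathematicalPhysics.QuantumLattice

/-! ### Mean-square bound and shift bookkeeping on `n → ℂ` -/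

section Kinematics

variable {n : Type*} [Fintype n]

/-- `Re⟨Σ_a u_a, Σ_b u_b⟩ = Σ_a Σ_b Re⟨u_a, u_b⟩` for the standard Hermitian form
`⟨u, v⟩ = star u ⬝ᵥ v`. [folklore] -/
theorem re_star_sum_dotProduct_sum {κ : Type*} (s : Finset κ) (u : κ → n → ℂ) :
    (star (∑ a ∈ s, u a) ⬝ᵥ (∑ b ∈ s, u b)).re = ∑ a ∈ s, ∑ b ∈ s, (star (u a) ⬝ᵥ u b).re := by
  rw [star_sum, sum_dotProduct, Complex.re_sum]
  refine Finset.sum_congr rfl fun a _ => ?_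
  rw [dotProduct_sum, Complex.re_sum]

/-- **Mean-square bound**: `‖Σ_{a∈s} u_a‖² ≤ |s| · Σ_{a∈s} ‖u_a‖²` (each cross term is at most the
mean of the two squares, `two_mul_re_star_dotProduct_le`). [folklore] -/
theorem re_star_sum_dotProduct_sum_le {κ : Type*} (s : Finset κ) (u : κ → n → ℂ) :
    (star (∑ a ∈ s, u a) ⬝ᵥ (∑ b ∈ s, u b)).re ≤ s.card * ∑ a ∈ s, (star (u a) ⬝ᵥ u a).re := by
  rw [re_star_sum_dotProduct_sum]
  have h : ∀ a b : κ, (star (u a) ⬝ᵥ u b).re ≤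
      (star (u a) ⬝ᵥ u a).re / 2 + (star (u b) ⬝ᵥ u b).re / 2 := by
    intro a b
    have := two_mul_re_star_dotProduct_le (u a) (u b)
    linarith
  calc ∑ a ∈ s, ∑ b ∈ s, (star (u a) ⬝ᵥ u b).re
      ≤ ∑ a ∈ s, ∑ b ∈ s, ((star (u a) ⬝ᵥ u a).re / 2 + (star (u b) ⬝ᵥ u b).re / 2) :=
        Finset.sum_le_sum fun a _ => Finset.sum_le_sum fun b _ => h a b
    _ = s.card * ∑ a ∈ s, (star (u a) ⬝ᵥ u a).re := by
        simp only [Finset.sum_add_distrib, Finset.sum_const, nsmul_eq_mul, ← Finset.mul_sum,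
          ← Finset.sum_div]
        ring

/-- Conjugate symmetry under the real part: `Re⟨u, v⟩ = Re⟨v, u⟩`. [folklore] -/
theorem re_star_dotProduct_comm (u v : n → ℂ) : (star u ⬝ᵥ v).re = (star v ⬝ᵥ u).re := by
  rw [star_dotProduct u v, Complex.star_def, Complex.conj_re]

/-- Backward shifts have the same summed overlap as forward shifts:
`Σ_a Re⟨v_a, v_{a-r}⟩ = Σ_a Re⟨v_a, v_{a+r}⟩` (reindex `a = b + r`, conjugate symmetry). [folklore] -/
theorem sum_re_star_dotProduct_shift_neg {L : ℕ} [NeZero L] (v : ZMod L → n → ℂ) (r : ZMod L) :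
    ∑ a : ZMod L, (star (v a) ⬝ᵥ v (a - r)).re = ∑ a : ZMod L, (star (v a) ⬝ᵥ v (a + r)).re := by
  have h1 : ∑ b : ZMod L, (star (v (b + r)) ⬝ᵥ v b).re =
      ∑ a : ZMod L, (star (v a) ⬝ᵥ v (a - r)).re :=
    Fintype.sum_equiv (Equiv.addRight r) _ _ (fun b => by simp)
  rw [← h1]
  exact Finset.sum_congr rfl fun b _ => re_star_dotProduct_comm _ _

/-- `Σ_a ‖v_a + v_{a-r}‖² = 2Σ_a ‖v_a‖² + 2Σ_a Re⟨v_a, v_{a+r}⟩`. [folklore] -/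
theorem sum_re_star_dotProduct_add_shift {L : ℕ} [NeZero L] (v : ZMod L → n → ℂ) (r : ZMod L) :
    ∑ a : ZMod L, (star (v a + v (a - r)) ⬝ᵥ (v a + v (a - r))).re =
      2 * ∑ a : ZMod L, (star (v a) ⬝ᵥ v a).re +
        2 * ∑ a : ZMod L, (star (v a) ⬝ᵥ v (a + r)).re := by
  have hexp : ∀ a : ZMod L, (star (v a + v (a - r)) ⬝ᵥ (v a + v (a - r))).re =
      (star (v a) ⬝ᵥ v a).re + (star (v (a - r)) ⬝ᵥ v (a - r)).re +
        ((star (v a) ⬝ᵥ v (a - r)).re + (star (v (a - r)) ⬝ᵥ v a).re) := by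
    intro a
    rw [star_add, add_dotProduct, dotProduct_add, dotProduct_add]
    simp only [Complex.add_re]
    ring
  simp only [hexp, Finset.sum_add_distrib]
  have hsq : ∑ a : ZMod L, (star (v (a - r)) ⬝ᵥ v (a - r)).re =
      ∑ a : ZMod L, (star (v a) ⬝ᵥ v a).re :=
    Fintype.sum_equiv (Equiv.subRight r) _ _ (fun a => by simp)
  have hcross : ∑ a : ZMod L, (star (v (a - r)) ⬝ᵥ v a).re =
      ∑ a : ZMod L, (star (v a) ⬝ᵥ v (a + r)).re :=
    Fintype.sum_equiv (Equiv.subRight r) _ _ (fun a => by simp)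
  rw [hsq, sum_re_star_dotProduct_shift_neg v r, hcross]
  ring

omit [Fintype n] in
/-- `Σ_a (v_a + v_{a-r}) = Σ_a v_a + Σ_a v_a`. [folklore] -/
theorem sum_add_shift {L : ℕ} [NeZero L] (v : ZMod L → n → ℂ) (r : ZMod L) :
    ∑ a : ZMod L, (v a + v (a - r)) = ∑ a : ZMod L, v a + ∑ a : ZMod L, v a := by
  rw [Finset.sum_add_distrib]
  congr 1
  exact Fintype.sum_equiv (Equiv.subRight r) _ _ (fun a => by simp)

/-- **Bochner floor, kinematic form.** For every family `v : ℤ/L → (n → ℂ)` and every shift `r`: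
`2‖Σ_a v_a‖²/L - Σ_a ‖v_a‖² ≤ Σ_a Re⟨v_a, v_{a+r}⟩` — the mean-square bound applied to
`u_a = v_a + v_{a-r}` (`Σ_a u_a = 2Σ_a v_a`, `Σ_a ‖u_a‖² = 2Σ_a‖v_a‖² + 2Σ_a Re⟨v_a, v_{a+r}⟩`).
Equivalently: the positive-definite function `r ↦ Σ_a ⟨v_a, v_{a+r}⟩` on `ℤ/L` is bounded below
pointwise by twice its mean minus its value at `0`. [folklore] -/
theorem bochnerFloor_family {L : ℕ} [NeZero L] (v : ZMod L → n → ℂ) (r : ZMod L) :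
    2 * (star (∑ a : ZMod L, v a) ⬝ᵥ (∑ a : ZMod L, v a)).re / L -
        ∑ a : ZMod L, (star (v a) ⬝ᵥ v a).re ≤
      ∑ a : ZMod L, (star (v a) ⬝ᵥ v (a + r)).re := by
  have hL : (0 : ℝ) < L := by exact_mod_cast Nat.pos_of_ne_zero (NeZero.ne L)
  set S := (star (∑ a : ZMod L, v a) ⬝ᵥ (∑ a : ZMod L, v a)).re with hS
  have h1 := re_star_sum_dotProduct_sum_le Finset.univ (fun a : ZMod L => v a + v (a - r))
  rw [Finset.card_univ, ZMod.card, sum_add_shift, sum_re_star_dotProduct_add_shift] at h1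
  have h4 : (star (∑ a : ZMod L, v a + ∑ a : ZMod L, v a) ⬝ᵥ
      (∑ a : ZMod L, v a + ∑ a : ZMod L, v a)).re = 4 * S := by
    rw [hS, star_add, add_dotProduct, dotProduct_add]
    simp only [Complex.add_re]
    ring
  rw [h4] at h1
  have h2 : 2 * S / L ≤ ∑ a : ZMod L, (star (v a) ⬝ᵥ v a).re +
      ∑ a : ZMod L, (star (v a) ⬝ᵥ v (a + r)).re := by
    rw [div_le_iff₀ hL]
    linarith
  linarith

end Kinematics

/-! ### The floor on the tubes -/

section Tube

variable (L M : ℕ) [NeZero L] [NeZero M] (Λ : Type) [LinearOrder Λ] [Fintype Λ]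
  (e : Λ ≃ ZMod L × ZMod M)

/-- **`G_ψ(-r) = G_ψ(r)`** for every Fock vector and every displacement. [folklore] -/
theorem tubeColumnPairCorr_neg (ψ : Fock (Orb Λ)) (r : ZMod L) :
    tubeColumnPairCorr L M Λ e ψ (-r) = tubeColumnPairCorr L M Λ e ψ r := by
  rw [tubeColumnPairCorr_eq_sum_dotProduct, tubeColumnPairCorr_eq_sum_dotProduct]
  simp only [← sub_eq_add_neg]
  exact sum_re_star_dotProduct_shift_neg
    (fun a => (∑ b : ZMod M, tubeDWavePair L M Λ e (e.symm (a, b))) *ᵥ ψ) r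

/-- **Sum rule**: `Σ_r G_ψ(r) = ‖Δψ‖²` with `Δ = Σ_a Φ_a = Σ_a Σ_b P_{e⁻¹(a,b)}` the total
`d_{x²-y²}` pair field of the tube (the `k = 0` column pair structure factor). [folklore] -/
theorem sum_tubeColumnPairCorr_eq (ψ : Fock (Orb Λ)) :
    ∑ r : ZMod L, tubeColumnPairCorr L M Λ e ψ r =
      (star ((∑ a : ZMod L, ∑ b : ZMod M, tubeDWavePair L M Λ e (e.symm (a, b))) *ᵥ ψ) ⬝ᵥ
        ((∑ a : ZMod L, ∑ b : ZMod M, tubeDWavePair L M Λ e (e.symm (a, b))) *ᵥ ψ)).re := by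
  simp only [tubeColumnPairCorr_eq_sum_dotProduct]
  rw [Finset.sum_comm, sum_mulVec, re_star_sum_dotProduct_sum]
  refine Finset.sum_congr rfl fun a _ => ?_
  exact Fintype.sum_equiv (Equiv.addLeft a)
    (fun r => (star ((∑ b : ZMod M, tubeDWavePair L M Λ e (e.symm (a, b))) *ᵥ ψ) ⬝ᵥ
      ((∑ b : ZMod M, tubeDWavePair L M Λ e (e.symm (a + r, b))) *ᵥ ψ)).re)
    (fun a' => (star ((∑ b : ZMod M, tubeDWavePair L M Λ e (e.symm (a, b))) *ᵥ ψ) ⬝ᵥ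
      ((∑ b : ZMod M, tubeDWavePair L M Λ e (e.symm (a', b))) *ᵥ ψ)).re)
    (fun r => rfl)

/-- **The total pair field is labelling-free**: `Σ_a Σ_b P_{e⁻¹(a,b)} = Σ_{x ∈ Λ} P_x` (reindex along
`e`); at `M = L` this is the summit's `d_{x²-y²}` pair field of the `L × L` torus. [folklore] -/
theorem sum_sum_tubeDWavePair_eq :
    ∑ a : ZMod L, ∑ b : ZMod M, tubeDWavePair L M Λ e (e.symm (a, b)) =
      ∑ x : Λ, tubeDWavePair L M Λ e x := by
  rw [← Fintype.sum_prod_type']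
  exact Fintype.sum_equiv e.symm _ _ (fun p => rfl)

/-- **BOCHNER FLOOR** (first lemma of crux idea `bochner-majority-split`, support lemma of
`pair-repulsion-dual`; kinematic, every Fock vector `ψ`, every labelled tube, every displacement):
`2(Σ_{r'} G_ψ(r'))/L - G_ψ(0) ≤ G_ψ(r)`, i.e. `G_ψ(r) ≥ 2‖Δψ‖²/L - G_ψ(0)`. Hence wherever more
than half of the column sum rule `Σ_{r'} G_ψ(r') ≤ L·G_ψ(0)` sits at `k = 0`, the correlator has a
POSITIVE pointwise floor at every `r` — no sign structure, positivity of weights or monotonicity is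
needed. [folklore] -/
theorem tubeColumnPairCorr_bochnerFloor (ψ : Fock (Orb Λ)) (r : ZMod L) :
    2 * (∑ r' : ZMod L, tubeColumnPairCorr L M Λ e ψ r') / L - tubeColumnPairCorr L M Λ e ψ 0 ≤
      tubeColumnPairCorr L M Λ e ψ r := by
  rw [sum_tubeColumnPairCorr_eq, tubeColumnPairCorr_eq_sum_dotProduct,
    tubeColumnPairCorr_eq_sum_dotProduct, sum_mulVec]
  simp only [add_zero]
  exact bochnerFloor_family (fun a => (∑ b : ZMod M, tubeDWavePair L M Λ e (e.symm (a, b))) *ᵥ ψ) r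

/-- **BOCHNER FLOOR, closed form** (all binders universally quantified; the registered sub-goal
`bochnerFloor` of crux stmt-HubbardSuperconductivity-16311): for every labelled tube, every Fock
vector and every displacement, `2(Σ_{r'} G_ψ(r'))/L - G_ψ(0) ≤ G_ψ(r)`. [folklore] -/
theorem bochnerFloor : ∀ (L M : ℕ) [NeZero L] [NeZero M] (Λ : Type) [LinearOrder Λ] [Fintype Λ] (e : Λ ≃ ZMod L × ZMod M) (ψ : Fock (Orb Λ)) (r : ZMod L), 2 * (∑ r' : ZMod L, tubeColumnPairCorr L M Λ e ψ r') / (L : ℝ) - tubeColumnPairCorr L M Λ e ψ 0 ≤ tubeColumnPairCorr L M Λ e ψ r :=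
  fun L M _ _ Λ _ _ e ψ r => tubeColumnPairCorr_bochnerFloor L M Λ e ψ r

/-- The Bochner floor with `‖Δψ‖²` written as the expectation `Re⟨ψ, Δ†Δ ψ⟩` (the form of the idea
sketches' `tubePairField` / `columnStructureFactorZero`). [folklore] -/
theorem tubeColumnPairCorr_bochnerFloor_expect (ψ : Fock (Orb Λ)) (r : ZMod L) :
    2 * (expect ((∑ a : ZMod L, ∑ b : ZMod M, tubeDWavePair L M Λ e (e.symm (a, b)))ᴴ *
          (∑ a : ZMod L, ∑ b : ZMod M, tubeDWavePair L M Λ e (e.symm (a, b)))) ψ).re / L -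
        tubeColumnPairCorr L M Λ e ψ 0 ≤
      tubeColumnPairCorr L M Λ e ψ r := by
  rw [PosSemidefTrace.expect_conjTranspose_mul, ← sum_tubeColumnPairCorr_eq]
  exact tubeColumnPairCorr_bochnerFloor L M Λ e ψ r

/-- The sum rule is bounded by the equal-column weight: `Σ_{r'} G_ψ(r') ≤ L·G_ψ(0)` (so the `k = 0`
fraction `‖Δψ‖²/(L·G_ψ(0))` lies in `[0, 1]`). [folklore] -/
theorem sum_tubeColumnPairCorr_le (ψ : Fock (Orb Λ)) :
    ∑ r' : ZMod L, tubeColumnPairCorr L M Λ e ψ r' ≤ L * tubeColumnPairCorr L M Λ e ψ 0 := by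
  calc ∑ r' : ZMod L, tubeColumnPairCorr L M Λ e ψ r'
      ≤ ∑ _r' : ZMod L, tubeColumnPairCorr L M Λ e ψ 0 :=
        Finset.sum_le_sum fun r' _ => tubeColumnPairCorr_le_zero L M Λ e ψ r'
    _ = L * tubeColumnPairCorr L M Λ e ψ 0 := by
        rw [Finset.sum_const, Finset.card_univ, ZMod.card, nsmul_eq_mul]

/-- The arithmetic of the wide-regime composition: a Bochner floor `2S/L - G₀ ≤ G_r`, pair order
`A·L²·M² ≤ S` and a `k = 0` majority `(1+ε)/2·L·G₀ ≤ S` (`ε > 0`, `G₀ ≥ 0`) give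
`(2ε/(1+ε))·A·L·M² ≤ G_r`. [folklore] -/
theorem majority_arith {L M S G₀ G ε A : ℝ} (hL : 0 < L) (hε : 0 < ε) (hG₀ : 0 ≤ G₀)
    (hfloor : 2 * S / L - G₀ ≤ G) (hA : A * L ^ 2 * M ^ 2 ≤ S)
    (hmaj : (1 + ε) / 2 * (L * G₀) ≤ S) :
    2 * ε / (1 + ε) * A * L * M ^ 2 ≤ G := by
  have hε1 : 0 < 1 + ε := by linarith
  have hL0 : L ≠ 0 := hL.ne'
  have hε0 : 1 + ε ≠ 0 := hε1.ne'
  have hG₀le : G₀ ≤ 2 * S / ((1 + ε) * L) := by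
    rw [le_div_iff₀ (mul_pos hε1 hL)]
    linarith
  have hSL : A * L * M ^ 2 ≤ S / L := by
    rw [le_div_iff₀ hL]
    linarith [show A * L * M ^ 2 * L = A * L ^ 2 * M ^ 2 by ring]
  have hc : 0 ≤ 2 * ε / (1 + ε) := div_nonneg (by linarith) hε1.le
  have hident : 2 * S / L - 2 * S / ((1 + ε) * L) = 2 * ε / (1 + ε) * (S / L) := by
    field_simp
    ring
  have hG₀' : 0 ≤ G₀ := hG₀
  calc 2 * ε / (1 + ε) * A * L * M ^ 2 = 2 * ε / (1 + ε) * (A * L * M ^ 2) := by ring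
    _ ≤ 2 * ε / (1 + ε) * (S / L) := mul_le_mul_of_nonneg_left hSL hc
    _ = 2 * S / L - 2 * S / ((1 + ε) * L) := hident.symm
    _ ≤ 2 * S / L - G₀ := by linarith
    _ ≤ G := hfloor

/-- **Wide-regime composition** (the arithmetic of card `bochner-majority-split`'s
`WideThinReduction`, wide half): if a vector carries tube pair order `A·L²·M² ≤ ‖Δψ‖²` and a `k = 0`
MAJORITY `(1+ε)/2 · L·G_ψ(0) ≤ ‖Δψ‖²` with `ε > 0`, then the column correlator obeys the pointwise,
exponent-free floor `(2ε/(1+ε))·A·L·M² ≤ G_ψ(r)` at EVERY displacement `r`. [folklore] -/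
theorem tubeColumnPairCorr_ge_of_majority (ψ : Fock (Orb Λ)) {ε A : ℝ} (hε : 0 < ε)
    (hA : A * (L : ℝ) ^ 2 * (M : ℝ) ^ 2 ≤ ∑ r' : ZMod L, tubeColumnPairCorr L M Λ e ψ r')
    (hmaj : (1 + ε) / 2 * ((L : ℝ) * tubeColumnPairCorr L M Λ e ψ 0) ≤
      ∑ r' : ZMod L, tubeColumnPairCorr L M Λ e ψ r') (r : ZMod L) :
    2 * ε / (1 + ε) * A * (L : ℝ) * (M : ℝ) ^ 2 ≤ tubeColumnPairCorr L M Λ e ψ r :=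
  majority_arith (by exact_mod_cast Nat.pos_of_ne_zero (NeZero.ne L)) hε
    (tubeColumnPairCorr_zero_nonneg L M Λ e ψ) (tubeColumnPairCorr_bochnerFloor L M Λ e ψ r) hA hmaj

end Tube

end Summit.HubbardSuperconductivity.HubbardSuperconductivity.Theorems.WidthHaldane

end
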